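import Summits.HubbardSuperconductivity.HubbardSuperconductivity.Theorems.WidthHaldaneDefs
import Summits.HubbardSuperconductivity.HubbardSuperconductivity.Theorems.WidthHaldaneBridge.Negative.UniformThermoVoidRegion
import Summits.HubbardSuperconductivity.HubbardSuperconductivity.Theorems.WidthHaldaneTubeBlochBound
import Summits.HubbardSuperconductivity.HubbardSuperconductivity.Theorems.WidthHaldaneColumnCorrelatorBounds

/-!
# Disproof of `WidthHaldaneBridge` (stmt-HubbardSuperconductivity-16311) — findings

cdisprove work file (refuter-cdisprove-stmt-HubbardSuperconductivity-16311-0, cycle 1, 2026-08-17).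
Crux: `Summit.HubbardSuperconductivity.HubbardSuperconductivity.Theses.WidthHaldane.WidthHaldaneBridge`
(= the `SeamInduction` copy by `rfl`), read over the landed vocabulary
`Theorems/WidthHaldaneDefs.lean` (`UniformThermo`, `HaldaneLaw`, `HaldaneLawAt`, `tubeStiffness`, …;
`widthHaldaneBridge_iff : WidthHaldaneBridge ↔ ∀ U>0, ∀ δ ∈ (0,3/10), ∀ d₀ k₀ M₁ L₀, 0<d₀ →
UniformThermo U δ d₀ k₀ M₁ L₀ → ∃ Ξ>0 A>0 R M₂ L₁, HaldaneLaw U δ Ξ A R M₂ L₁`).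

## VERDICT (cycle 1): RESISTS — no kill, no misstatement; one Negative lemma landed.

WHY IT RESISTS (kernel-checked below, §1): the crux is an implication whose ONLY load-bearing
hypothesis is `UniformThermo` at ADVERSARY-CHOSEN data, and every admissible data set still asks
`d₀ ≤ ρ̃_{L,M}` and `0 < ẽ″_{L,M} ≤ k₀` for arbitrarily large tubes INCLUDING the square tori `M = L`.
Hence `¬ WidthHaldaneBridge → ∃ (U,δ) in the window and data with 0 < d₀ ≤ 2, 0 < k₀ such that
UniformThermo holds` (`not_widthHaldaneBridge_imp_two`; the landed `Negative.not_widthHaldaneBridge_imp`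
has `≤ 4`): a refutation must CERTIFY width-uniform
superfluid stiffness and pair compressibility of the pure 2D Hubbard model at T = 0 — the sibling
crux `WidthUniformThermodynamics` (stmt-16312, the judge's hardest, summit-strength). Conversely
`(∀ data, ¬UniformThermo) → WidthHaldaneBridge` (`widthHaldaneBridge_of_forall_not_uniformThermo`):
in the "no uniform stiffness anywhere in the window" world (the Qin et al. 2020 stripe scenario
extended to all U) the crux is VACUOUSLY TRUE. So the crux is decidable only together with
stmt-16312, in either direction. No finite computation bears on it (all thresholds existential).

## Index
* §1 STRUCTURE — (`Negative.not_widthHaldaneBridge_imp`, landed), `widthUniformThermodynamics_of_not_widthHaldaneBridge`,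
  `widthHaldaneBridge_of_forall_not_uniformThermo`,
  `not_widthHaldaneBridge_imp_two`, `widthHaldaneBridge_iff_nonvoid` (the crux restricted to the
  non-void data region `0 < d₀ ≤ 2, 0 < k₀` is equivalent to the crux).
* §2 LOAD-BEARING ANALYSIS — the void region of `UniformThermo`: `tubeStiffness_diag_le_four`
  (Bloch ceiling `ρ̃_{L,L} ≤ 4`, from Literature `fluxEnergy_le_fluxEnergy_zero_add_two_mul_sq`),
  `uniformThermo_false_of_four_lt`, `uniformThermo_false_of_nonpos` — LANDED as
  `Theorems/WidthHaldaneBridge/Negative/UniformThermoVoidRegion.lean` (p146238, ACCEPTED; imported here). Hypothesis-by-hypothesis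
  table in the docstring of `WidthHaldaneBridgeWithoutUT`; the one informative `_false_without_`
  statement (`widthHaldaneBridge_false_without_UT`) is a documented NEAR-MISS (sorry): it needs an
  UPPER bound on ground-state column pair correlations of arbitrarily large tubes, for which no
  rigorous tool exists at T = 0 (kinematic ceiling `G ≤ 32·L·M²` is useless; Koma–Tasaki decay is
  T > 0; HMW-type no-LRO at FIXED width does not contradict a power law with exponent `> 0`).
* §3 NATURAL STRENGTHENINGS / JUNK — `haldaneLawAt_width_zero` (the `M = 0` slice is vacuously
  true: width floors are junk-safe); amplitude scale `L·M²` is the kinematic maximum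
  (prover file `WidthHaldaneColumnCorrelatorBounds`; here `columnPairCorr_le_ceiling`,
  `haldaneLawAt_amplitude_le`), so at
  `M ≍ L` the law IS d-wave LRO of the square torus (cf. `WidthHaldane.closes`, which consumes only
  that diagonal instance).
* §4 LINE `birth` (lead c10, PICKED) — `GlueStep` (matrix of `stub_seamGluing`),
  `haldaneLawAt_mono`, `dyadic_tower_of_glueStep`: the gluing stub ALONE transports the law at ONE
  width `M'` to every dyadic multiple `2^k M'` with constants `(Ξ·e^{2c/M'}, A·e^{-2c/M'})` and the
  SAME thresholds — in particular to the square tori of side `2^k M'`: "one good width ⇒ 2D d-wave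
  LRO with amplitude ≥ A·e^{-2c/M'}". Both birth stubs are guarded by `UniformThermo` exactly like
  the crux ⇒ no unconditional `stub_false` is reachable either; recorded soft spots in the docstrings.
* §5 LINE `column_factorisation` (registered skeleton f0147d97) — prose: both stubs UT-guarded;
  `RelativeLaw` forces sign-definiteness `G_ψ(r) ≥ 0` for `r̂ ≥ R` in EVERY sector ground state;
  `ColumnWeight` at `M ≍ L` is already the 2D order statement.
* §6 PHYSICAL FAILURE SCENARIOS (not formalisable today; for the provers' awareness).
* §7 Targets: none this cycle (payload `stuck_stubs = []`).
-/

noncomputable section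

namespace Summit.HubbardSuperconductivity.HubbardSuperconductivity.Cruxes.WidthHaldaneBridge.Disproof

set_option linter.dupNamespace false

open scoped BigOperators Classical Matrix ComplexConjugate
open Matrix Literature.MathematicalPhysics.QuantumLattice Literature.Probability.LatticeModels
open Summit.HubbardSuperconductivity.HubbardSuperconductivity.Theorems.WidthHaldane
open Summit.HubbardSuperconductivity.HubbardSuperconductivity.Theses.WidthHaldane
  (WidthHaldaneBridge WidthUniformThermodynamics)

/-! ## §2 LOAD-BEARING ANALYSIS: the void region of `UniformThermo`

LANDED (p146238, ACCEPTED, commit 17ec6f399a8d) as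
`Theorems/WidthHaldaneBridge/Negative/UniformThermoVoidRegion.lean`, namespace
`…Theorems.WidthHaldaneBridge.Negative` (opened below; ideators / planners / provers may import it):
* `tubeH0_diag_eq_hubbardTorus`, `tubeTwist_diag_eq_seamTwist`, `tubeEnergy_diag_eq_fluxEnergy` — the
  diagonal instance `M = L` of the crux's objects on `FermionTorus 2 L` IS the Literature flux
  envelope (this also certifies the seam-twist SIGN CONVENTION: `tubeH0 + tubeTwist θ` has seam
  hopping `-e^{±iθ}`, a proper Peierls phase — the lead's c10 worry "sign conventions of the seam
  twist" is settled);
* `tubeStiffness_diag_le_four` — Bloch ceiling `ρ̃_{L,L}(U,δ) ≤ 4`;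
* `uniformThermo_false_of_four_lt`, `uniformThermo_false_of_nonpos` — `UniformThermo` is void for
  `d₀ > 4` and for `k₀ ≤ 0`;
* `not_widthHaldaneBridge_imp` — `¬ WidthHaldaneBridge → ∃ (U,δ) ∈ window, 0 < d₀ ≤ 4, 0 < k₀, M₁, L₀,
  UniformThermo …`.
SHARPER, landed by the prover side minutes later (2026-08-17T07:25Z,
`Theorems/WidthHaldaneTubeBlochBound.lean`, namespace `…Theorems.WidthHaldane`, imported here): the
GENERAL-TUBE Bloch bound `tubeEnergy_le_tubeEnergy_zero_add` (`E_{L,M}(θ) ≤ E_{L,M}(0) + θ²M/L`,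
`L ≥ 3`, every `M`, every labelling; hop amplitudes `≤ ½`), `tubeStiffness_le_two` (`ρ̃_{L,M} ≤ 2`)
and `uniformThermo_floor_le_two` (`UniformThermo → d₀ ≤ 2`). So the void region is in fact
`d₀ > 2`; `not_widthHaldaneBridge_imp_two` / `widthHaldaneBridge_iff_nonvoid` below use it.
-/

open Summit.HubbardSuperconductivity.HubbardSuperconductivity.Theorems.WidthHaldaneBridge.Negative

/-- HYPOTHESIS-BY-HYPOTHESIS TABLE (what dropping each hypothesis of the crux does):
* `UniformThermo` (THE load-bearing one): dropped ⇒ the bare law below; physically false (striped /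
  insulating tubes at large U, small δ), but NOT provably false — see
  `widthHaldaneBridge_false_without_UT` (near-miss). Weakening it to its stiffness half or its
  compressibility half changes nothing for refutability (both halves are unprovable at every point).
* `0 < U`: dropping it admits `U = 0` (free fermions), but free tubes are METALS and fail
  `UniformThermo` for every data (the π/3-envelope flattens once `M ≫ 1`: stiff ~ 1/M²; shell/parity
  effects; refuter rattack's U = 0 toy, ATTACK.md 2026-08-17: 321/522 small tubes with stiff ≤ 0) ⇒ the
  `U ≥ 0` version is refutable only through the same wall. `U < 0` (attractive) would be s-wave, and
  the B1g column correlator `G` is then small — a refutation of the `U ≠ 0` variant would still need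
  `UniformThermo` certified for the attractive model (open as well, though easier: Lieb's theorem gives
  uniqueness/singlet, not stiffness).
* `δ ∈ (0, 3/10)`: dropping the upper end admits the low-density window where the leading
  weak-coupling harmonic is not d_{x²-y²} (p / d_xy / g); physically the crux should fail there under
  `UniformThermo`, but again only modulo `UniformThermo`. `δ = 0` (half filling): Mott insulator at
  every `U > 0` (ẽ″ → ∞ expected) ⇒ UT fails ⇒ vacuous.
* `0 < d₀`: inert (with `d₀ ≤ 0` the stiffness clause weakens but `0 < ẽ″ ≤ k₀` remains unprovable).
* `Even L`, `Even M`, `NeZero`, `M ≤ L`, labelling-universality: structural; the `M = 0` slice of the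
  conclusion is vacuously true (`haldaneLawAt_width_zero`), energies/expectations are labelling- and
  Jordan–Wigner-order covariant (diagonal ±1 unitary), so no junk instance is reachable.
* normalisation `star ψ ⬝ᵥ ψ = 1` and `IsGroundStateInSector`: dropping ground-state-ness makes the
  law false for trivial reasons (a Fock basis state in the sector has `G_ψ(r) = 0` for `r̂ ≥ 2`), but
  that double mutation (it also needs UT dropped to be closed unconditionally) informs nobody.
This `def` is the bare law (UT dropped), kept for the record. -/
def WidthHaldaneBridgeWithoutUT : Prop :=
  ∀ U : ℝ, 0 < U → ∀ δ ∈ Set.Ioo (0 : ℝ) (3 / 10),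
    ∃ Ξ : ℝ, 0 < Ξ ∧ ∃ A : ℝ, 0 < A ∧ ∃ R M₂ L₁ : ℕ, HaldaneLaw U δ Ξ A R M₂ L₁

/-- NEAR-MISS (not close — recorded to document the obstruction). To close it one needs, at ONE
`(U, δ)` of the window, for every `(Ξ, A, R, M₂, L₁)` a tube `M₂ ≤ M ≤ L`, `L ≥ L₁` and a normalised
sector ground state `ψ` with `G_ψ(r) < A·L·M²·r̂^{-Ξ√(ẽ″/ρ̃)/M}` for some admissible `r`: an UPPER
bound on d-wave column pair correlations of a Hubbard GROUND STATE of an arbitrarily large tube.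
Tried / available: (i) kinematic ceiling `G ≤ 32·L·M²` (operator norm, `‖P_x‖ ≤ 4√2`) — never below
the claimed floor since `A` is existential; (ii) Koma–Tasaki / McBryan–Spencer decay — positive
temperature only; (iii) HMW-type absence of LRO at FIXED width `M` (strategist's `NoFixedWidthLRO`) —
consistent with the law, whose exponent `Ξ√(ẽ″/ρ̃)/M` is `> 0` at fixed `M` (and `ρ̃, ẽ″` are not
even sign-controlled without UT: the exponent may be the junk `√(negative) = 0`, in which case the law
asks fixed-width LRO `G ≥ A·L·M²` and (iii) WOULD bite — but proving `ρ̃_{L,M} < 0` cofinally for the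
interacting tube is again out of reach); (iv) exact solutions: none for `M ≥ 2` (Lieb–Wu is `M = 1`,
which the evenness clause excludes; and even there pair correlation asymptotics are not rigorous).
[folklore] -/
theorem widthHaldaneBridge_false_without_UT : ¬ WidthHaldaneBridgeWithoutUT := by
  sorry

/-! ## §1 STRUCTURE: what a refutation must certify; the vacuity world -/

/-- **What a refutation must certify (sharp form)**: `¬ WidthHaldaneBridge` forces width-uniform
thermodynamics at some `(U,δ)` of the window with `0 < d₀ ≤ 2`, `0 < k₀` (prover's
`uniformThermo_floor_le_two` + `Negative.uniformThermo_false_of_nonpos`). [folklore] -/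
theorem not_widthHaldaneBridge_imp_two (h : ¬ WidthHaldaneBridge) :
    ∃ U : ℝ, 0 < U ∧ ∃ δ ∈ Set.Ioo (0 : ℝ) (3 / 10), ∃ d₀ : ℝ, 0 < d₀ ∧ d₀ ≤ 2 ∧ ∃ k₀ : ℝ, 0 < k₀ ∧
      ∃ M₁ L₀ : ℕ, UniformThermo U δ d₀ k₀ M₁ L₀ := by
  obtain ⟨U, hU, δ, hδ, d₀, hd₀, -, k₀, hk₀, M₁, L₀, hth⟩ := not_widthHaldaneBridge_imp h
  exact ⟨U, hU, δ, hδ, d₀, hd₀, uniformThermo_floor_le_two hth, k₀, hk₀, M₁, L₀, hth⟩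

/-- Corollary: `¬ WidthHaldaneBridge → WidthUniformThermodynamics` — the two cruxes of route
`WidthHaldane` cannot both fail. [folklore] -/
theorem widthUniformThermodynamics_of_not_widthHaldaneBridge (h : ¬ WidthHaldaneBridge) :
    WidthUniformThermodynamics := by
  obtain ⟨U, hU, δ, hδ, d₀, hd₀, -, k₀, -, M₁, L₀, hth⟩ := not_widthHaldaneBridge_imp h
  exact widthUniformThermodynamics_iff.2 ⟨U, hU, δ, hδ, d₀, hd₀, k₀, M₁, L₀, hth⟩

/-- **The vacuity world**: if the pure tubes have width-uniform thermodynamics NOWHERE in the window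
(no d-wave-relevant superconductivity of the t' = 0 Hubbard model at any `U > 0`, `δ < 0.3` — the
Qin et al. 2020 stripe scenario extended to all couplings), the crux holds for lack of instances.
A proof of the crux "by physics" therefore only ever concerns points where stmt-16312 holds.
[folklore] -/
theorem widthHaldaneBridge_of_forall_not_uniformThermo
    (h : ∀ U : ℝ, 0 < U → ∀ δ ∈ Set.Ioo (0 : ℝ) (3 / 10), ∀ (d₀ k₀ : ℝ) (M₁ L₀ : ℕ), 0 < d₀ →
      ¬ UniformThermo U δ d₀ k₀ M₁ L₀) :
    WidthHaldaneBridge :=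
  widthHaldaneBridge_iff.2 fun U hU δ hδ d₀ k₀ M₁ L₀ hd₀ hth => absurd hth (h U hU δ hδ d₀ k₀ M₁ L₀ hd₀)

/-- **The crux lives on the non-void data region** `0 < d₀ ≤ 2`, `0 < k₀`: restricting the data
there gives an EQUIVALENT statement (provers may assume `d₀ ≤ 2 ∧ 0 < k₀` for free). [folklore] -/
theorem widthHaldaneBridge_iff_nonvoid :
    WidthHaldaneBridge ↔
      ∀ U : ℝ, 0 < U → ∀ δ ∈ Set.Ioo (0 : ℝ) (3 / 10), ∀ (d₀ k₀ : ℝ) (M₁ L₀ : ℕ), 0 < d₀ → d₀ ≤ 2 →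
        0 < k₀ → UniformThermo U δ d₀ k₀ M₁ L₀ →
          ∃ Ξ : ℝ, 0 < Ξ ∧ ∃ A : ℝ, 0 < A ∧ ∃ R M₂ L₁ : ℕ, HaldaneLaw U δ Ξ A R M₂ L₁ := by
  rw [widthHaldaneBridge_iff]
  constructor
  · intro h U hU δ hδ d₀ k₀ M₁ L₀ hd₀ _ _ hth
    exact h U hU δ hδ d₀ k₀ M₁ L₀ hd₀ hth
  · intro h U hU δ hδ d₀ k₀ M₁ L₀ hd₀ hth
    by_cases hk : 0 < k₀
    · exact h U hU δ hδ d₀ k₀ M₁ L₀ hd₀ (uniformThermo_floor_le_two hth) hk hth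
    · exact absurd hth (uniformThermo_false_of_nonpos (not_lt.mp hk))

/-! ## §3 NATURAL STRENGTHENINGS / JUNK SLICES -/

/-- The `M = 0` slice of the per-width law is vacuously true (`NeZero 0` is uninhabited): width
floors `M₂` in the crux and in every stub are junk-safe, and nothing can be refuted at `M = 0`.
[folklore] -/
theorem haldaneLawAt_width_zero (U δ Ξ A : ℝ) (R L₁ : ℕ) : HaldaneLawAt U δ 0 Ξ A R L₁ := by
  intro L _ hM
  exact absurd hM.out (by simp)

/-! KINEMATIC CEILING — already LANDED by the prover side (2026-08-17T07:21Z, minutes before this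
seat's redundant proposal p146714, which bounced `dedup.landed` and is withdrawn):
`Theorems/WidthHaldaneColumnCorrelatorBounds.lean` (namespace `…Theorems.WidthHaldane`, imported here):
`tubeColumnPairCorr_le_zero` (`G_ψ(r) ≤ G_ψ(0)`, Cauchy–Schwarz + reindexing),
`tubeColumnPairCorr_zero_nonneg` (`0 ≤ G_ψ(0) = Σ_a ‖Φ_a ψ‖²`), `eucNorm_tubeDWavePair_mulVec_le`
(`‖P_x v‖ ≤ 4√2‖v‖`), `eucNorm_columnPair_mulVec_le` (`‖Φ_a v‖ ≤ 4√2·M‖v‖`),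
`tubeColumnPairCorr_zero_le` (`G_ψ(0) ≤ 32·L·M²` for unit `ψ`). Hence `G_ψ(r) ≤ 32·L·M²` for every
unit vector and every `r` (`columnPairCorr_le_ceiling` below): the crux's amplitude normalisation
`A·L·M²` is the KINEMATIC MAXIMUM up to the constant `32`, and any relative law `a·G(0)·r̂^{-…} ≤ G(r)` needs
`a·r̂^{-…} ≤ 1` wherever `G(0) > 0`.
Consequently (a) the strengthening "`A·L·M^{2+ε}`" is false for every `ε > 0` (trivially, once tubes
with `M^ε > 32/A` are in range), and (b) at `M ≍ L`, `r̂ ≍ L` the claimed floor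
`A·L·M²·r̂^{-Ξ√(ẽ″/ρ̃)/M} ≥ A·e^{-Ξ√(k₀/d₀)}·L·M²` is a POSITIVE FRACTION of the kinematic maximum:
genuine d-wave ODLRO of the square torus in EVERY sector ground state (this is exactly the instance
`WidthHaldane.closes` consumes; strategist finding F1). Any weakening of the crux that keeps `closes`
alive must keep this diagonal LRO content. -/

/-- `G_ψ(r) ≤ 32·L·M²` for every unit vector (the two landed prover bounds chained). [folklore] -/
theorem columnPairCorr_le_ceiling (L M : ℕ) [NeZero L] [NeZero M] (Λ : Type) [LinearOrder Λ]
    [Fintype Λ] (e : Λ ≃ ZMod L × ZMod M) {ψ : Fock (Orb Λ)} (hψ : star ψ ⬝ᵥ ψ = 1) (r : ZMod L) :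
    tubeColumnPairCorr L M Λ e ψ r ≤ 32 * (L : ℝ) * (M : ℝ) ^ 2 :=
  (tubeColumnPairCorr_le_zero L M Λ e ψ r).trans (tubeColumnPairCorr_zero_le L M Λ e hψ)

/-- **Admissible amplitudes are kinematically bounded**: a per-width law `HaldaneLawAt U δ M Ξ A R L₁`
forces `A·r̂^{-Ξ√(ẽ″/ρ̃)/M} ≤ 32` at every admissible instance (tube, unit sector ground state,
displacement); with `r̂ = 1` admissible, `A ≤ 32`. [folklore] -/
theorem haldaneLawAt_amplitude_le {U δ : ℝ} {M : ℕ} {Ξ A : ℝ} {R L₁ : ℕ}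
    (h : HaldaneLawAt U δ M Ξ A R L₁) (L : ℕ) [NeZero L] [NeZero M] (hLe : Even L) (hML : M ≤ L)
    (hL : L₁ ≤ L) (Λ : Type) [LinearOrder Λ] [Fintype Λ] (e : Λ ≃ ZMod L × ZMod M)
    (ψ : Fock (Orb Λ)) (hψ : star ψ ⬝ᵥ ψ = 1)
    (hGS : IsGroundStateInSector (tubeH0 L M Λ e U) (tubeFilling L M δ) 0 ψ) (r : ZMod L)
    (hr : R ≤ r.val) (hrL : r.val + R ≤ L) :
    A * ((min r.val (L - r.val) : ℕ) : ℝ) ^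
        (-(Ξ * Real.sqrt (tubePairCompressibility L M Λ e U δ / tubeStiffness L M Λ e U δ) / (M : ℝ))) ≤
      32 := by
  have key := (h L hLe hML hL Λ e ψ hψ hGS r hr hrL).trans (columnPairCorr_le_ceiling L M Λ e hψ r)
  have hLM : (0 : ℝ) < (L : ℝ) * (M : ℝ) ^ 2 := by
    have hL0 : (0 : ℝ) < L := Nat.cast_pos.2 (NeZero.pos L)
    have hM0 : (0 : ℝ) < M := Nat.cast_pos.2 (NeZero.pos M)
    positivity
  have key' : (A * ((min r.val (L - r.val) : ℕ) : ℝ) ^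
        (-(Ξ * Real.sqrt (tubePairCompressibility L M Λ e U δ / tubeStiffness L M Λ e U δ) / (M : ℝ)))) *
      ((L : ℝ) * (M : ℝ) ^ 2) ≤ 32 * ((L : ℝ) * (M : ℝ) ^ 2) := by
    calc _ = A * (L : ℝ) * (M : ℝ) ^ 2 * ((min r.val (L - r.val) : ℕ) : ℝ) ^
          (-(Ξ * Real.sqrt (tubePairCompressibility L M Λ e U δ / tubeStiffness L M Λ e U δ) /
            (M : ℝ))) := by ring
      _ ≤ _ := key
      _ = _ := by ring
  exact le_of_mul_le_mul_right key' hLM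

/-! ## §4 LINE `birth`: the gluing stub alone climbs the dyadic tower from ONE width -/

/-- Real-arithmetic core of monotonicity (copy of `Lines/birth.lean core_mono`). [folklore] -/
theorem core_mono {A A' Ξ Ξ' Lr Msq x s Mr Gv : ℝ}
    (h : A * Lr * Msq * x ^ (-(Ξ * s / Mr)) ≤ Gv) (hΞ : Ξ ≤ Ξ') (hA : A' ≤ A) (hA' : 0 ≤ A')
    (hx : 1 ≤ x) (hs : 0 ≤ s) (hMr : 0 < Mr) (hLr : 0 ≤ Lr) (hMsq : 0 ≤ Msq) :
    A' * Lr * Msq * x ^ (-(Ξ' * s / Mr)) ≤ Gv := by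
  have hX : 0 ≤ x ^ (-(Ξ' * s / Mr)) := Real.rpow_nonneg (zero_le_one.trans hx) _
  have h1 : x ^ (-(Ξ' * s / Mr)) ≤ x ^ (-(Ξ * s / Mr)) := by
    apply Real.rpow_le_rpow_of_exponent_le hx
    have : Ξ * s / Mr ≤ Ξ' * s / Mr :=
      div_le_div_of_nonneg_right (mul_le_mul_of_nonneg_right hΞ hs) hMr.le
    linarith
  have step1 : A' * Lr * Msq * x ^ (-(Ξ' * s / Mr)) ≤ A * Lr * Msq * x ^ (-(Ξ' * s / Mr)) := by
    apply mul_le_mul_of_nonneg_right _ hX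
    apply mul_le_mul_of_nonneg_right _ hMsq
    exact mul_le_mul_of_nonneg_right hA hLr
  have hALM : 0 ≤ A * Lr * Msq := mul_nonneg (mul_nonneg (hA'.trans hA) hLr) hMsq
  have step2 : A * Lr * Msq * x ^ (-(Ξ' * s / Mr)) ≤ A * Lr * Msq * x ^ (-(Ξ * s / Mr)) :=
    mul_le_mul_of_nonneg_left h1 hALM
  exact step1.trans (step2.trans h)

/-- Monotonicity of the per-width law in its constants (port of `Lines/birth.lean lawAt_mono` to the
landed predicate `HaldaneLawAt`). [folklore] -/
theorem haldaneLawAt_mono {U δ : ℝ} {M : ℕ} {Ξ Ξ' A A' : ℝ} {R R' L₁ L₁' : ℕ}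
    (h : HaldaneLawAt U δ M Ξ A R L₁) (hΞ : Ξ ≤ Ξ') (hA : A' ≤ A) (hA' : 0 ≤ A') (hR : R ≤ R')
    (hR1 : 1 ≤ R') (hL : L₁ ≤ L₁') : HaldaneLawAt U δ M Ξ' A' R' L₁' := by
  intro L _ _ hLe hML hL₁ Λ _ _ e ψ hψ hGS r hr hrL
  have key := h L hLe hML (hL.trans hL₁) Λ e ψ hψ hGS r (hR.trans hr)
    (le_trans (Nat.add_le_add_left hR _) hrL)
  have hx : (1 : ℝ) ≤ ((min r.val (L - r.val) : ℕ) : ℝ) := by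
    have h1 : 1 ≤ r.val := hR1.trans hr
    have h2 : 1 ≤ L - r.val := by
      have := le_trans (Nat.add_le_add_left hR1 _) hrL
      omega
    exact_mod_cast le_min h1 h2
  have hMr : (0 : ℝ) < (M : ℝ) := by exact_mod_cast Nat.pos_of_ne_zero (NeZero.ne M)
  exact core_mono key hΞ hA hA' hx (Real.sqrt_nonneg _) hMr (Nat.cast_nonneg L) (sq_nonneg _)

/-- The MATRIX of `stub_seamGluing` once its existentials `c, M₂, R₀, L₂` are fixed (over the landed
`HaldaneLawAt`, δζ-convertible with the skeleton's `LawAt`). [folklore] -/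
def GlueStep (U δ c : ℝ) (M₂ R₀ L₂ : ℕ) : Prop :=
  ∀ M' M'' : ℕ, Even M' → Even M'' → M₂ ≤ M' → M' ≤ M'' → M'' ≤ M' + 2 →
    ∀ (Ξ A : ℝ) (R L₁ : ℕ), 0 < Ξ → 0 < A → R₀ ≤ R → L₂ ≤ L₁ →
      HaldaneLawAt U δ M' Ξ A R L₁ → HaldaneLawAt U δ M'' Ξ A R L₁ →
        HaldaneLawAt U δ (M' + M'') (Ξ * Real.exp (c / (M' : ℝ))) (A * Real.exp (-(c / (M' : ℝ)))) R L₁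

/-- **Dyadic tower from ONE width.** Under the gluing matrix alone (no per-width base beyond a single
width `M' ≥ max(M₂, 1)`), the law at `M'` with constants `(Ξ, A, R ≥ R₀, L₁ ≥ L₂)` propagates to
EVERY dyadic multiple `2^k·M'` with the exact budget `(Ξ·e^{2c/M' − 2c/(2^k M')}, A·e^{−(…)})` and
UNCHANGED thresholds `R, L₁` (self-gluing `M'' = M'` is admissible: `M' ≤ M' ≤ M' + 2`).
Consequence for the lead (c10): `stub_seamGluing` asserts in particular "law at one width `M'` ⇒
law on the square tori of side `2^k M' ≥ L₁` with amplitude `≥ A·e^{-2c/M'}`", i.e. ONE quasi-1D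
Luther–Emery law ⇒ 2D d-wave LRO with a COMPARABLE, `k`-independent amplitude — the whole
dimensional crossover plus a non-universal amplitude identity, in one inequality. [folklore] -/
theorem dyadic_tower_of_glueStep {U δ c : ℝ} {M₂ R₀ L₂ : ℕ}
    (hg : GlueStep U δ c M₂ R₀ L₂) {M' : ℕ} (hM'e : Even M') (hM' : M₂ ≤ M') (hM'1 : 1 ≤ M')
    {Ξ A : ℝ} {R L₁ : ℕ} (hΞ : 0 < Ξ) (hA : 0 < A) (hR : R₀ ≤ R) (hL : L₂ ≤ L₁)
    (h : HaldaneLawAt U δ M' Ξ A R L₁) (k : ℕ) :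
    HaldaneLawAt U δ (2 ^ k * M')
      (Ξ * Real.exp (2 * c / (M' : ℝ) - 2 * c / ((2 ^ k * M' : ℕ) : ℝ)))
      (A * Real.exp (-(2 * c / (M' : ℝ) - 2 * c / ((2 ^ k * M' : ℕ) : ℝ)))) R L₁ := by
  induction k with
  | zero =>
    simpa [sub_self, Real.exp_zero] using h
  | succ k ih =>
    have hm1 : 1 ≤ 2 ^ k * M' := Nat.one_le_iff_ne_zero.2 (by positivity)
    have hme : Even (2 ^ k * M') := hM'e.mul_left _
    have hmM : M₂ ≤ 2 ^ k * M' := hM'.trans (Nat.le_mul_of_pos_left _ (by positivity))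
    have hstep := hg (2 ^ k * M') (2 ^ k * M') hme hme hmM le_rfl (by omega) _ _ R L₁
      (by positivity) (by positivity) hR hL ih ih
    have h2 : 2 ^ k * M' + 2 ^ k * M' = 2 ^ (k + 1) * M' := by ring
    rw [h2] at hstep
    have hm0 : (0 : ℝ) < ((2 ^ k * M' : ℕ) : ℝ) := by exact_mod_cast hm1
    have hcast : (((2 ^ (k + 1) * M' : ℕ) : ℝ)) = 2 * ((2 ^ k * M' : ℕ) : ℝ) := by push_cast; ring
    have hbudget : 2 * c / (M' : ℝ) - 2 * c / ((2 ^ k * M' : ℕ) : ℝ) + c / ((2 ^ k * M' : ℕ) : ℝ) =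
        2 * c / (M' : ℝ) - 2 * c / ((2 ^ (k + 1) * M' : ℕ) : ℝ) := by
      rw [hcast]; field_simp; ring
    have e1 : Ξ * Real.exp (2 * c / (M' : ℝ) - 2 * c / ((2 ^ (k + 1) * M' : ℕ) : ℝ)) =
        Ξ * Real.exp (2 * c / (M' : ℝ) - 2 * c / ((2 ^ k * M' : ℕ) : ℝ)) *
          Real.exp (c / ((2 ^ k * M' : ℕ) : ℝ)) := by
      rw [mul_assoc, ← Real.exp_add, hbudget]
    have e2 : A * Real.exp (-(2 * c / (M' : ℝ) - 2 * c / ((2 ^ (k + 1) * M' : ℕ) : ℝ))) =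
        A * Real.exp (-(2 * c / (M' : ℝ) - 2 * c / ((2 ^ k * M' : ℕ) : ℝ))) *
          Real.exp (-(c / ((2 ^ k * M' : ℕ) : ℝ))) := by
      rw [mul_assoc, ← Real.exp_add, ← hbudget, neg_add]
    rw [e1, e2]
    exact hstep

/-- Uniform-constant form of the tower: law at ONE width `M'` ⇒ law at every `2^k·M'` with
`(Ξ·e^{2c/M'}, A·e^{-2c/M'}, max R 1, L₁)`. In particular (take `2^k M' ≥ L₁` and the square tube
`L = M = 2^k M'`): column d-wave LRO of arbitrarily large square tori with amplitude
`A·e^{-2c/M'}·e^{-Ξ e^{2c/M'}√(k₀/d₀)}` follows from the law at the single width `M'`. [folklore] -/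
theorem dyadic_tower_uniform {U δ c : ℝ} {M₂ R₀ L₂ : ℕ} (hc : 0 ≤ c)
    (hg : GlueStep U δ c M₂ R₀ L₂) {M' : ℕ} (hM'e : Even M') (hM' : M₂ ≤ M') (hM'1 : 1 ≤ M')
    {Ξ A : ℝ} {R L₁ : ℕ} (hΞ : 0 < Ξ) (hA : 0 < A) (hR : R₀ ≤ R) (hL : L₂ ≤ L₁)
    (h : HaldaneLawAt U δ M' Ξ A R L₁) (k : ℕ) :
    HaldaneLawAt U δ (2 ^ k * M') (Ξ * Real.exp (2 * c / (M' : ℝ)))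
      (A * Real.exp (-(2 * c / (M' : ℝ)))) (max R 1) L₁ := by
  have ht := dyadic_tower_of_glueStep hg hM'e hM' hM'1 hΞ hA hR hL h k
  have hnn : 0 ≤ 2 * c / ((2 ^ k * M' : ℕ) : ℝ) := by positivity
  refine haldaneLawAt_mono ht ?_ ?_ (by positivity) (le_max_left _ _) (le_max_right _ _) le_rfl
  · exact mul_le_mul_of_nonneg_left (Real.exp_le_exp.2 (by linarith)) hΞ.le
  · exact mul_le_mul_of_nonneg_left (Real.exp_le_exp.2 (by linarith)) hA.le

/-! SOFT SPOTS of the birth stubs (no unconditional kill reachable — both are `UniformThermo`-guarded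
exactly like the crux; recorded for the lead):
* `stub_seamGluing`: (i) uniform in `(Ξ, A)` with `c, R₀, L₂` independent of them — as `Ξ → ∞` the
  hypotheses degenerate to "G > tiny" while the conclusion's exponent is ~ HALF of the hypotheses'
  (at intensive `ẽ″/ρ̃`), so the stub is exactly as strong as Luther–Emery/Haldane COVARIANCE
  `η(M)·M/√(ẽ″/ρ̃) = const` across ALL widths `≥ M₂` at the given `(U,δ)`; a single width pair where
  gluing changes the universality class (C1S0 + C1S0 → CEX / C2S1, Lin–Balents–Fisher 1997 §V) with an
  O(1) jump kills it for every `c`; (ii) by `dyadic_tower_uniform` it pins the 2D order parameter to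
  the quasi-1D amplitude (`|Φ_2D|² ≳ e^{-2c/M'}·A_{M'}`), a NON-UNIVERSAL amplitude relation;
  (iii) thresholds `R, L₁` unchanged under gluing = seam healing length O(1) uniformly in the width.
* `stub_perWidthHaldaneLaw`: per width it is the (open) multiband Luther–Emery theorem; its `∃ M₂`
  floor dodges finitely many anomalous widths only — a cofinal family of non-C1S0 widths kills it. -/

/-! ## §5 LINE `column_factorisation` (registered skeleton; stubs `stub_transverseCoherence`,
`stub_relativeColumnLaw`) — prose only (its slice predicates live in the sorried skeleton):
* both stubs are `UniformThermo`-guarded ⇒ no unconditional `stub_false`;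
* `stub_relativeColumnLaw` (`a·G_ψ(0)·r̂^{-Ξ√(ẽ″/ρ̃)/M} ≤ G_ψ(r)`) forces in particular
  SIGN-DEFINITENESS `G_ψ(r) ≥ 0` for all `R ≤ r̂` in EVERY sector ground state of every admissible
  tube (since `G_ψ(0) = Σ_a ‖Φ_a ψ‖² ≥ 0`); a single ground state with a negative column correlation
  at one admissible distance (e.g. a `2k_F`/PDW-modulated quasi-order whose oscillating part wins at
  some `r̂ ≥ R` cofinally in `L`) refutes it — numerically checkable per width (DMRG sign of the
  column-summed d-wave correlator), not formally;
* `stub_transverseCoherence` (`Σ_a‖Φ_aψ‖² ≥ A₀·L·M²` up to `M = L`) IS 2D order at `M ≍ L`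
  (kinematic maximum `32·L·M²`, §3 remark): conjecture-strength by design, not attackable here. -/

/-! ## §6 PHYSICAL FAILURE SCENARIOS (where the crux should be FALSE although `UniformThermo` holds;
none formalisable today — each needs a certified phase of the 2D Hubbard model; lit search daemon was
down during this session, citations are bibliographic):
1. SMECTIC / SLIDING LUTHER–EMERY PHASE with stripes ALONG the long cycle: each stripe spin-gapped with
   h/2e flux response ⇒ `ρ̃ > 0` uniformly, compressible ⇒ UT holds; but no transverse pair coherence
   ⇒ `G_ψ(r) ≍ L·M·r̂^{-η₁}` (incoherent column sum) `≪ A·L·M²` for `M > 32/A`: crux false.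
   (Emery–Fradkin–Kivelson–Lubensky, PRL 85 (2000) 2160; Vishwanath–Carpentier, PRL 86 (2001) 676;
   Mukhopadhyay–Kane–Lubensky, PRB 64 (2001) 045120.) The crux's hypothesis twists only the LONG
   cycle and cannot see this (strategist idea `two-cycle-stiffness` addresses exactly this gap).
2. NON-B1g CONDENSATE with uniform thermodynamics (d_xy / g / p harmonic, or CEX `q_y = π` pairing of
   glued ladders, Lin–Balents–Fisher PRB 56 (1997) 6569 §V): `Σ_b P_(a,b)` averages out ⇒ `G = O(L·M)`.
   The window `δ < 3/10` was chosen to stay inside the weak-coupling d_{x²-y²} regime of the `t' = 0`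
   band (Raghu–Kivelson–Scalapino PRB 81 (2010) 224505; Deng–Kozik–Prokof'ev–Svistunov EPL 110 (2015)
   57001) — the margin at intermediate `U` is not known.
3. PAIR-DENSITY-WAVE / striped superconductor with ordering vector along the long cycle: `G_ψ(r)`
   changes sign in `r` ⇒ violates `G ≥ positive` cofinally (also kills `stub_relativeColumnLaw`).
4. C1Sn (gapless spin/relative modes) at some widths: pair exponent `> Ξ√(ẽ″/ρ̃)/M` cofinally in `M`
   (the crux's own recorded failure mode).

METAL BASELINE (U = 0, the only exactly computable point; it FAILS `UniformThermo`, so it refutes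
nothing — it calibrates the strategist's "disprover-wanted" quantity, the equal-time column pair
structure factor vs `M`). Free fermions on the `L × M` torus, `δ = 1/4`, lowest levels filled per spin,
Wick's theorem (`scratch/free_column_weight.py`, this seat, local, seconds):
`L  M   G(0)/(L·M)  G(0)/(L·M²)  G(L/2)/(L·M²)`
`16 4   0.85        0.212        0.0046`
`16 8   0.65        0.082        0.0028`
`16 16  0.67        0.042        0.0013`
`24 4   1.08        0.271        0.0003`
`24 8   0.81        0.101        0.0012`
`24 16  0.78        0.049        0.0007`
— the INCOHERENT scaling `G(0) ≍ L·M` (no transverse pair coherence) and no long-distance weight; the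
crux (and `stub_transverseCoherence`) demand `G ≍ L·M²` down to `r̂ ≍ L`, i.e. a factor `≍ M` of
coherence that only a phase-locked condensate supplies. Any numerics at `U > 0` should be reported in
these units. -/

/-! ## §7 Targets: none this cycle (`stuck_stubs = []`, `targets = []`). -/

end Summit.HubbardSuperconductivity.HubbardSuperconductivity.Cruxes.WidthHaldaneBridge.Disproof

end
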